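import Literature.Analysis.FluidPDE.TaoH1FourierMildExists
import Literature.Analysis.FluidPDE.TaoH1FourierMildClassical
import Literature.Analysis.FluidPDE.TaoH1FourierDecompositionProofs
import Literature.Analysis.FluidPDE.TaoLocalisationContinuation
import HarnessLib

/-!
# Crux `MixingPayoff` (stmt-NavierStokesRegularity-1422), line `birth`: tools for STUB
  `stub_windowRegularity` (all space–time derivatives of the velocity are bounded on a closed slab)

Helper file (theorems only; lands `--supports stmt-NavierStokesRegularity-1422`) for the
registered stub `stub_windowRegularity` of the skeleton `Cruxes/MixingPayoff/Lines/birth.lean`.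
The stub needs, on a closed slab `[0, T] × ℝ³`, sup bounds on ALL joint (space–time) iterated
derivatives of the velocity of a classical Navier–Stokes solution, i.e. the pointwise form of
Tao 2011, Thm. 5.4 (iv) ("`∂ₜʲ u ∈ L^∞_t H^k_x([0, T] × ℝ³)` for all `j, k ≥ 0`", arXiv:1108.1165,
Thm. 31, p. 18, with the closing note that an `H^∞` datum suffices). The tree proves Thm. 5.4 on
the Fourier side (`IsSobolevMild`, `TaoH1FourierMild*.lean`): the velocity is the synthesis
`u(t) = Re 𝓕 v(t)` and, for every `n`, `v` is the zeroth member of a square-dominated family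
`W₀ = v, W₁ = ∂ₜv, …, W_n` (`IsSobolevMild.exists_family`, `IsDomFamily`). This file adds:

* `windowRegularity_iteratedFDerivWithin_synth_le` — for a square-dominated family of order `n`
  the synthesized field `synth W (t, x) = 𝓕 (W₀ t) x` has its `n`-th iterated derivative WITHIN
  the closed slab bounded on the slab (induction on `n`, exactly as the tree's
  `contDiffOn_synth_dom`: the derivative within the slab is the synthesis of the shifted family
  in the time direction and of the symbol-multiplied families `dmul eᵢ W` in the space
  directions, `fderivWithin_synth_apply_dom`; order `0` is `‖𝓕 f‖_∞ ≤ ‖f‖_{L¹}` with the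
  integrable dominator `IsDomFamily.dom_L1`);
* `windowRegularity_iteratedFDerivWithin_synthVel_le` — hence all joint derivatives within the
  slab of `uncurry (fun t => synthVel (v t))` are bounded, for `v` an `IsSobolevMild` solution;
* `w1aux_localExistenceAllDerivs` — Tao's local existence theorem Thm. 5.4 (ii)+(iv) in the
  form "smooth divergence-free `H^∞` datum `u₀` with `‖u₀‖²_{H¹} ≤ A`, `A² T ≤ c ν³` ⇒ classical
  solution on `[0, T] × ℝ³` with `u 0 = u₀`, all Sobolev norms bounded AND all joint derivatives
  within the slab bounded" (the proved chain `sobolev_fourierDatum_of_smooth_holds`,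
  `tao2011_sobolevMild_exists_holds`, `IsSobolevMild.isClassicalNSSolutionOn`);
* `windowRegularity_restart` — the restart step of the classical continuation argument
  (Robinson–Rodrigo–Sadowski 2016, proof of Lemma 6.11; the tree's
  `hasBoundedSobolevNormsOn_restart` with the stronger local theorem): for a classical solution
  on `[0, T] × ℝ³` with all Sobolev norms bounded, the local solution from `u(s)` coincides with
  `u(· + s)` (Prodi–Serrin weak–strong uniqueness, `serrin_weak_strong_uniqueness_holds`), so its
  derivative bounds are bounds for the joint derivatives of `u` within `[0, T] × ℝ³` over
  `[s, min(s + τ, T)]`, `τ = c ν³/(A² + 1)` uniform.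

Everything is proved; no definition, no named fact. References: T. Tao, Anal. PDE 6 (2013) =
arXiv:1108.1165, Thm. 5.4; J. C. Robinson, J. L. Rodrigo, W. Sadowski, *The Three-Dimensional
Navier–Stokes Equations* (CUP 2016), Lemma 6.11, Thm. 8.19; J. Leray, Acta Math. 63 (1934), §19.
-/

noncomputable section

open scoped ContDiff FourierTransform ENNReal NNReal Pointwise
open MeasureTheory Set Function Metric Real Complex

-- `Summit = Problem` for this summit; the tree lakefile sets `weak.linter.dupNamespace = false`.
set_option linter.dupNamespace false

namespace Summit.NavierStokesRegularity.NavierStokesRegularity.Theorems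

open Literature.Analysis.FluidPDE Literature.Analysis.FluidPDE.FourierNS

local notation "E3" => EuclideanSpace ℝ (Fin 3)

/-! ### Sup bounds on all joint derivatives of synthesized fields -/

/-- Order zero: a field synthesized from a square-dominated family is bounded on the closed slab
(`‖𝓕 f‖_∞ ≤ ‖f‖_{L¹}` with the integrable dominator of order `0`). -/
theorem windowRegularity_norm_synth_le {T : ℝ} (hT : 0 ≤ T) {n : ℕ} {W : ℕ → ℝ → E3 → ℂ}
    (hW : IsDomFamily T n W) :
    ∃ C : ℝ, ∀ z ∈ Icc 0 T ×ˢ (univ : Set E3), ‖synth W z‖ ≤ C := by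
  obtain ⟨g, hg, -, hle⟩ := hW.dom_L1 hT (Nat.zero_le _) 0
  refine ⟨∫ ξ, g ξ, fun z hz => ?_⟩
  rw [synth]
  calc ‖𝓕 (W 0 z.1) z.2‖ ≤ ∫ ξ, ‖W 0 z.1 ξ‖ :=
        VectorFourier.norm_fourierIntegral_le_integral_norm _ _ _ _ _
    _ ≤ ∫ ξ, g ξ :=
        integral_mono_of_nonneg (Filter.Eventually.of_forall fun ξ => norm_nonneg _) hg
          (Filter.Eventually.of_forall fun ξ => by simpa using hle z.1 hz.1 ξ)

/-- **All joint derivatives within the closed slab of a field synthesized from a square-dominated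
Fourier family of order `n` are bounded up to order `n`** (induction on `n`: the derivative within
the slab is the synthesis of the shifted family in the time direction and of the symbol-multiplied
families in the space directions, `fderivWithin_synth_apply_dom`). -/
theorem windowRegularity_iteratedFDerivWithin_synth_le {T : ℝ} (hT : 0 < T) :
    ∀ (n : ℕ) (W : ℕ → ℝ → E3 → ℂ), IsDomFamily T n W →
      ∃ C : ℝ, ∀ z ∈ Icc 0 T ×ˢ (univ : Set E3),
        ‖iteratedFDerivWithin ℝ n (synth W) (Icc 0 T ×ˢ univ) z‖ ≤ C := by
  intro n
  induction n with
  | zero =>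
    intro W hW
    obtain ⟨C, hC⟩ := windowRegularity_norm_synth_le hT.le hW
    exact ⟨C, fun z hz => by rw [norm_iteratedFDerivWithin_zero]; exact hC z hz⟩
  | succ n ih =>
    intro W hW
    have hs : UniqueDiffOn ℝ (Icc 0 T ×ˢ (univ : Set E3)) := uniqueDiffOn_slab hT
    set e : Fin 3 → E3 := fun i => EuclideanSpace.single i (1 : ℝ) with he
    -- the families synthesizing the pieces of the first derivative
    have hW₁ : IsDomFamily T n (fun k => W (k + 1)) := hW.shift
    have hWe : ∀ i, IsDomFamily T n (dmul (e i) W) := fun i =>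
      (hW.dmul (e i)).mono (Nat.le_succ n)
    obtain ⟨C₀, hC₀⟩ := ih _ hW₁
    choose Ce hCe using fun i => ih _ (hWe i)
    -- the fixed rank-one operators
    set A : ℂ →L[ℝ] (ℝ × E3 →L[ℝ] ℂ) :=
      ContinuousLinearMap.smulRightL ℝ (ℝ × E3) ℂ (ContinuousLinearMap.fst ℝ ℝ E3) with hA
    set B : Fin 3 → (ℂ →L[ℝ] (ℝ × E3 →L[ℝ] ℂ)) := fun i =>
      ContinuousLinearMap.smulRightL ℝ (ℝ × E3) ℂ
        ((EuclideanSpace.proj i).comp (ContinuousLinearMap.snd ℝ ℝ E3)) with hB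
    set F₀ : ℝ × E3 → (ℝ × E3 →L[ℝ] ℂ) :=
      (A : ℂ → (ℝ × E3 →L[ℝ] ℂ)) ∘ synth (fun k => W (k + 1)) with hF₀
    set F : Fin 3 → ℝ × E3 → (ℝ × E3 →L[ℝ] ℂ) := fun i =>
      (B i : ℂ → (ℝ × E3 →L[ℝ] ℂ)) ∘ synth (dmul (e i) W) with hF
    -- the first derivative within the slab, decomposed
    have hΦ : EqOn (fderivWithin ℝ (synth W) (Icc 0 T ×ˢ univ)) (F₀ + ∑ i, F i)
        (Icc 0 T ×ˢ (univ : Set E3)) := by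
      intro z hz
      obtain ⟨L, hL, hLy⟩ := hasFDerivWithinAt_synth_dom hT hW hz
      rw [hL.fderivWithin (hs z hz)]
      have hL0 : ∀ h : E3, L ((0 : ℝ), h) = synth (dmul h W) z := fun h => by
        rw [hLy]; simp
      have hL1 : L ((1 : ℝ), (0 : E3)) = synth (fun k => W (k + 1)) z := by
        rw [hLy]; simp [synth_dmul_zero]
      refine ContinuousLinearMap.ext fun y => ?_
      have h2 : y.2 = ∑ i, y.2 i • e i := by
        conv_lhs => rw [← (EuclideanSpace.basisFun (Fin 3) ℝ).sum_repr y.2]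
        simp [he]
      have hsplit : y = ((y.1, (0 : E3)) : ℝ × E3) + ((0 : ℝ), y.2) := by ext <;> simp
      have h1' : ((y.1, (0 : E3)) : ℝ × E3) = y.1 • ((1 : ℝ), (0 : E3)) := by ext <;> simp
      have hLHS : L y =
          y.1 • synth (fun k => W (k + 1)) z + ∑ i, y.2 i • synth (dmul (e i) W) z := by
        calc L y = L (y.1, 0) + L (0, y.2) := by conv_lhs => rw [hsplit]; rw [map_add]
          _ = y.1 • L (1, 0) + L.comp (ContinuousLinearMap.inr ℝ ℝ E3) y.2 := by
              rw [h1', map_smul]; rfl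
          _ = y.1 • synth (fun k => W (k + 1)) z + ∑ i, y.2 i • synth (dmul (e i) W) z := by
              rw [hL1]
              congr 1
              conv_lhs => rw [h2]
              rw [map_sum]
              refine Finset.sum_congr rfl fun i _ => ?_
              rw [map_smul, ContinuousLinearMap.comp_apply, ContinuousLinearMap.inr_apply, hL0]
      have hRHS : (F₀ + ∑ i, F i) z y =
          y.1 • synth (fun k => W (k + 1)) z + ∑ i, y.2 i • synth (dmul (e i) W) z := by
        simp [hF₀, hF, hA, hB, Finset.sum_apply]
      rw [hLHS, hRHS]
    -- smoothness of the pieces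
    have hc₁ : ContDiffOn ℝ n (synth (fun k => W (k + 1))) (Icc 0 T ×ˢ univ) :=
      contDiffOn_synth_dom hT n _ hW₁
    have hce : ∀ i, ContDiffOn ℝ n (synth (dmul (e i) W)) (Icc 0 T ×ˢ univ) := fun i =>
      contDiffOn_synth_dom hT n _ (hWe i)
    refine ⟨‖A‖ * C₀ + ∑ i, ‖B i‖ * Ce i, fun z hz => ?_⟩
    have hF₀c : ContDiffWithinAt ℝ n F₀ (Icc 0 T ×ˢ univ) z :=
      A.contDiff.comp_contDiffWithinAt (hc₁ z hz)
    have hFc : ∀ i, ContDiffWithinAt ℝ n (F i) (Icc 0 T ×ˢ univ) z := fun i =>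
      (B i).contDiff.comp_contDiffWithinAt (hce i z hz)
    have hFsc : ContDiffWithinAt ℝ n (∑ i, F i) (Icc 0 T ×ˢ univ) z := by
      rw [Finset.sum_fn]
      exact ContDiffWithinAt.sum fun i _ => hFc i
    rw [← norm_iteratedFDerivWithin_fderivWithin hs hz, iteratedFDerivWithin_congr hΦ hz n,
      iteratedFDerivWithin_add_apply hF₀c hFsc hs hz,
      iteratedFDerivWithin_sum_apply hs hz fun i _ => hFc i]
    refine (norm_add_le _ _).trans (add_le_add ?_ ((norm_sum_le _ _).trans
      (Finset.sum_le_sum fun i _ => ?_)))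
    · exact (A.norm_iteratedFDerivWithin_comp_left (hc₁ z hz) hs hz le_rfl).trans
        (mul_le_mul_of_nonneg_left (hC₀ z hz) (norm_nonneg _))
    · exact ((B i).norm_iteratedFDerivWithin_comp_left (hce i z hz) hs hz le_rfl).trans
        (mul_le_mul_of_nonneg_left (hCe i z hz) (norm_nonneg _))

/-- **All joint derivatives within the closed slab of the velocity `u(t) = Re 𝓕 v(t)` synthesized
from a Fourier-side `H¹`-mild solution of Sobolev class are bounded** (Tao 2011, Thm. 5.4 (iv):
`∂ₜʲ u ∈ L^∞_t H^k_x` for all `j, k`, in the pointwise form: the components are real parts of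
syntheses of the square-dominated families `IsSobolevMild.exists_family`). -/
theorem windowRegularity_iteratedFDerivWithin_synthVel_le {c T : ℝ} {a : E3 → Fin 3 → ℂ}
    {v : ℝ → E3 → Fin 3 → ℂ} (hv : IsSobolevMild c T a v) (hc : 0 ≤ c) (hT : 0 < T)
    (ha : IsSobolevFourierDatum a) (n : ℕ) :
    ∃ C : ℝ, ∀ z ∈ Icc 0 T ×ˢ (univ : Set E3),
      ‖iteratedFDerivWithin ℝ n (uncurry fun t => synthVel (v t)) (Icc 0 T ×ˢ univ) z‖ ≤ C := by
  have hs : UniqueDiffOn ℝ (Icc 0 T ×ˢ (univ : Set E3)) := uniqueDiffOn_slab hT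
  obtain ⟨W, hW0, hW⟩ := hv.exists_family hc hT ha n
  set e : Fin 3 → E3 := fun i => EuclideanSpace.single i (1 : ℝ) with he
  set Lr : Fin 3 → (ℂ →L[ℝ] E3) := fun l => (Complex.reCLM).smulRight (e l) with hLr
  set G : Fin 3 → ℝ × E3 → E3 := fun l =>
    (Lr l : ℂ → E3) ∘ synth (fun k t ξ => W k t ξ l) with hG
  have hrepr : (uncurry fun t => synthVel (v t)) = ∑ l, G l := by
    funext z
    rw [Finset.sum_apply]
    have h1 : synthVel (v z.1) z.2 = ∑ l, (synthVel (v z.1) z.2) l • e l := by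
      conv_lhs => rw [← (EuclideanSpace.basisFun (Fin 3) ℝ).sum_repr (synthVel (v z.1) z.2)]
      simp [he]
    change synthVel (v z.1) z.2 = _
    rw [h1]
    refine Finset.sum_congr rfl fun l _ => ?_
    simp only [hG, hLr, Function.comp_apply, ContinuousLinearMap.smulRight_apply,
      Complex.reCLM_apply, synth, hW0, synthVel_apply]
  choose C hC using fun l => windowRegularity_iteratedFDerivWithin_synth_le hT n _ (hW l)
  refine ⟨∑ l, ‖Lr l‖ * C l, fun z hz => ?_⟩
  have hcl : ∀ l, ContDiffOn ℝ n (synth fun k t ξ => W k t ξ l) (Icc 0 T ×ˢ univ) := fun l =>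
    contDiffOn_synth_dom hT n _ (hW l)
  have hGc : ∀ l, ContDiffWithinAt ℝ n (G l) (Icc 0 T ×ˢ univ) z := fun l =>
    (Lr l).contDiff.comp_contDiffWithinAt (hcl l z hz)
  rw [hrepr, iteratedFDerivWithin_sum_apply hs hz fun l _ => hGc l]
  refine (norm_sum_le _ _).trans (Finset.sum_le_sum fun l _ => ?_)
  exact ((Lr l).norm_iteratedFDerivWithin_comp_left (hcl l z hz) hs hz le_rfl).trans
    (mul_le_mul_of_nonneg_left (hC l z hz) (norm_nonneg _))

/-! ### Local existence with all joint derivatives bounded, and the restart step -/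

/-- **Local existence with all space–time derivatives bounded on the closed slab** (Tao 2011,
Thm. 5.4 (ii)+(iv), arXiv Thm. 31, p. 18: "`∂ₜʲu ∈ L^∞_t H^k([0, T] × ℝ³)` for all `j, k ≥ 0`",
with the closing note that an `H^∞` datum suffices; lifespan `c ν³ / ‖u₀‖⁴_{H¹}`). The tree's
proved Fourier-side chain (`sobolev_fourierDatum_of_smooth_holds`,
`tao2011_sobolevMild_exists_holds`, `IsSobolevMild.isClassicalNSSolutionOn`,
`IsSobolevMild.hasBoundedSobolevNormsOn_u`) together with the pointwise bounds
`windowRegularity_iteratedFDerivWithin_synthVel_le`. -/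
theorem w1aux_localExistenceAllDerivs :
    ∃ c : ℝ, 0 < c ∧ ∀ ⦃ν T : ℝ⦄, 0 < ν → 0 < T → ∀ ⦃u₀ : E3 → E3⦄,
      ContDiff ℝ ∞ u₀ → VectorCalculus.IsDivFree u₀ →
      (∀ n : ℕ, ∫⁻ x, ‖iteratedFDeriv ℝ n u₀ x‖ₑ ^ 2 < ⊤) →
      ∀ ⦃A : ℝ⦄, 0 ≤ A →
        (∫⁻ x, ‖u₀ x‖ₑ ^ 2) + (∫⁻ x, ENNReal.ofReal (frobeniusNormSq (fderiv ℝ u₀ x))) ≤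
            ENNReal.ofReal A →
        A ^ 2 * T ≤ c * ν ^ 3 →
        ∃ (u : ℝ → E3 → E3) (p : ℝ → E3 → ℝ),
          IsClassicalNSSolutionOn (Icc 0 T) ν 0 u p ∧ u 0 = u₀ ∧
          HasBoundedSobolevNormsOn (Icc 0 T) u ∧
          ∀ n : ℕ, ∃ C : ℝ, ∀ z ∈ Icc 0 T ×ˢ (univ : Set E3),
            ‖iteratedFDerivWithin ℝ n (uncurry u) (Icc 0 T ×ˢ univ) z‖ ≤ C := by
  obtain ⟨c₀, hc₀, hE⟩ := tao2011_sobolevMild_exists_holds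
  refine ⟨c₀, hc₀, fun ν T hν hT u₀ hsm hdiv hH A hA hH1 hsmall => ?_⟩
  obtain ⟨a, ha, hsynth, hPl⟩ := sobolev_fourierDatum_of_smooth_holds hsm hdiv hH
  obtain ⟨a', hm', ha', -, hsynth', hH1eq⟩ := ha.exists_measurable_repr
  have hH1' : fourierH1Sq a' ≤ ENNReal.ofReal A := by rw [hH1eq, hPl]; exact hH1
  obtain ⟨v, hv⟩ := hE hν hT ha' hm' hA hH1' hsmall
  have hc : (0 : ℝ) ≤ 4 * π ^ 2 * ν := by positivity
  refine ⟨fun t => synthVel (v t), _, hv.isClassicalNSSolutionOn hν.le hT ha', ?_,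
    hv.hasBoundedSobolevNormsOn_u hc ha' (Icc 0 T),
    windowRegularity_iteratedFDerivWithin_synthVel_le hv hc hT ha'⟩
  change synthVel (v 0) = u₀
  rw [← hsynth, ← hsynth']
  congr 1
  funext ξ
  exact hv.apply_zero hT.le ξ

/-- **Restart step with transfer of all space–time derivatives** (Robinson–Rodrigo–Sadowski 2016,
proof of Lemma 6.11: restart from `u(s)` with the local strong solution and weak–strong
uniqueness). For a classical solution on the closed slab `[0, T] × ℝ³` with all Sobolev norms
bounded and `‖u(s)‖²_{H¹} ≤ Ab` at every time, the local solution `w` from the datum `u(s)` given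
by `hloc` (lifespan `τ = c ν³/(Ab² + 1)`, all joint derivatives bounded) coincides with
`u(· + s)` on `[0, min(τ, T - s)]` (both are Leray–Hopf solutions from `u(s)`,
`isLerayHopfOn_of_finiteEnergy` / `isLerayHopfOn_translate_of_finiteEnergy`, `w` is in the Serrin
class `L^∞_t L^∞_x`, `serrin_weak_strong_uniqueness_holds`), so the bounds on the joint
derivatives of `w` within its slab are bounds on those of `u` within `[0, T] × ℝ³` over
`[s, min(s + τ, T)]` (translation invariance and `iteratedFDerivWithin_subset`). -/
theorem windowRegularity_restart {c : ℝ} (hc : 0 < c)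
    (hloc : ∀ ⦃ν T : ℝ⦄, 0 < ν → 0 < T → ∀ ⦃u₀ : E3 → E3⦄,
      ContDiff ℝ ∞ u₀ → VectorCalculus.IsDivFree u₀ →
      (∀ n : ℕ, ∫⁻ x, ‖iteratedFDeriv ℝ n u₀ x‖ₑ ^ 2 < ⊤) →
      ∀ ⦃A : ℝ⦄, 0 ≤ A →
        (∫⁻ x, ‖u₀ x‖ₑ ^ 2) + (∫⁻ x, ENNReal.ofReal (frobeniusNormSq (fderiv ℝ u₀ x))) ≤
            ENNReal.ofReal A →
        A ^ 2 * T ≤ c * ν ^ 3 →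
        ∃ (u : ℝ → E3 → E3) (p : ℝ → E3 → ℝ),
          IsClassicalNSSolutionOn (Icc 0 T) ν 0 u p ∧ u 0 = u₀ ∧
          HasBoundedSobolevNormsOn (Icc 0 T) u ∧
          ∀ n : ℕ, ∃ C : ℝ, ∀ z ∈ Icc 0 T ×ˢ (univ : Set E3),
            ‖iteratedFDerivWithin ℝ n (uncurry u) (Icc 0 T ×ˢ univ) z‖ ≤ C)
    {ν T : ℝ} (hν : 0 < ν) {u : ℝ → E3 → E3} {p : ℝ → E3 → ℝ}
    (hsol : IsClassicalNSSolutionOn (Icc 0 T) ν 0 u p)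
    (hH : HasBoundedSobolevNormsOn (Icc 0 T) u) {Ab : ℝ} (hAb : 0 ≤ Ab)
    (hbound : ∀ s ∈ Icc 0 T, (∫⁻ x, ‖u s x‖ₑ ^ 2) +
      (∫⁻ x, ENNReal.ofReal (frobeniusNormSq (fderiv ℝ (u s) x))) ≤ ENNReal.ofReal Ab)
    (n : ℕ) ⦃s : ℝ⦄ (hs0 : 0 ≤ s) (hsT : s < T) :
    ∃ C : ℝ, ∀ t ∈ Icc s (min (s + c * ν ^ 3 / (Ab ^ 2 + 1)) T), ∀ x : E3,
      ‖iteratedFDerivWithin ℝ n (uncurry u) (Icc 0 T ×ˢ univ) (t, x)‖ ≤ C := by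
  set τ : ℝ := c * ν ^ 3 / (Ab ^ 2 + 1) with hτ
  have hτpos : 0 < τ := by positivity
  set τ' : ℝ := min τ (T - s) with hτ'
  have hτ'pos : 0 < τ' := lt_min hτpos (by linarith)
  have hτ'τ : τ' ≤ τ := min_le_left _ _
  have hsτ'T : s + τ' ≤ T := by have := min_le_right τ (T - s); linarith
  have hmin : min (s + τ) T = s + τ' := by
    have h := min_add_add_left s τ (T - s); rwa [add_sub_cancel] at h
  -- the datum `u(s)`
  have hsI : s ∈ Icc 0 T := ⟨hs0, hsT.le⟩
  have hus : ContDiff ℝ ∞ (u s) := hsol.contDiff_velocity hsI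
  have hdiv : VectorCalculus.IsDivFree (u s) := hsol.divFree s hsI
  have hHk : ∀ n : ℕ, ∫⁻ x, ‖iteratedFDeriv ℝ n (u s) x‖ₑ ^ 2 < ⊤ := fun n => by
    obtain ⟨Cn, hCn⟩ := hH n
    exact (hCn s hsI).trans_lt ENNReal.coe_lt_top
  have hsmallE : Ab ^ 2 * τ' ≤ c * ν ^ 3 :=
    calc Ab ^ 2 * τ' ≤ Ab ^ 2 * τ := by gcongr
      _ ≤ (Ab ^ 2 + 1) * τ := by gcongr; linarith
      _ = c * ν ^ 3 := by rw [hτ]; field_simp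
  -- the local classical solution `w` from `u(s)` with all derivatives bounded
  obtain ⟨w, q, hw, hw0, hHBw, hDw⟩ := hloc hν hτ'pos hus hdiv hHk hAb (hbound s hsI) hsmallE
  have hwC : ∀ t ∈ Icc 0 τ', ContDiff ℝ ∞ (w t) := fun t ht => hw.contDiff_velocity ht
  -- finite energy of `w` and of `u`; both are Leray–Hopf solutions from `u(s)`
  have h0 : ∀ (f : E3 → E3) (x : E3), ‖iteratedFDeriv ℝ 0 f x‖ₑ = ‖f x‖ₑ := fun f x => by
    rw [← ofReal_norm, ← ofReal_norm, norm_iteratedFDeriv_zero]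
  obtain ⟨C₀, hC₀⟩ := hHBw 0
  have hfew : ∃ A : ℝ≥0∞, A < ⊤ ∧ ∀ t ∈ Icc 0 τ', ∫⁻ x, ‖w t x‖ₑ ^ 2 ≤ A :=
    ⟨C₀, ENNReal.coe_lt_top, fun t ht => by simpa only [h0] using hC₀ t ht⟩
  have hLHw : IsLerayHopfOn τ' ν 0 (u s) w := by
    have h := (isLerayHopfOn_of_finiteEnergy hw hν hτ'pos hfew).1
    rwa [hw0] at h
  obtain ⟨D₀, hD₀⟩ := hH 0
  have hfe : ∀ t ∈ Icc 0 T, ∫⁻ x, ‖u t x‖ₑ ^ 2 ≤ (D₀ : ℝ≥0∞) := fun t ht => by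
    simpa only [h0] using hD₀ t ht
  have hsτ'pos : 0 < s + τ' := by linarith
  have hsol'' : IsClassicalNSSolutionOn (Icc 0 (s + τ')) ν 0 u p :=
    hsol.mono (Icc_subset_Icc_right hsτ'T) (uniqueDiffOn_Icc hsτ'pos)
  have hfe'' : ∃ A : ℝ≥0∞, A < ⊤ ∧ ∀ t ∈ Icc 0 (s + τ'), ∫⁻ x, ‖u t x‖ₑ ^ 2 ≤ A :=
    ⟨D₀, ENNReal.coe_lt_top, fun t ht => hfe t (Icc_subset_Icc_right hsτ'T ht)⟩
  have hLHu : IsLerayHopfOn τ' ν 0 (u s) (fun t => u (t + s)) := by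
    have h := (isLerayHopfOn_translate_of_finiteEnergy hsol'' hν hs0 (by linarith) hfe'').1
    rwa [add_sub_cancel_left] at h
  -- weak–strong uniqueness in the Serrin class `L^∞_t L^∞_x`
  have hS : MemLqLp ⊤ ⊤ w (Ioo 0 τ') :=
    memLqLp_top_top_of_hasBoundedSobolevNormsOn hτ'pos hwC hHBw
  have hu₀ : MemLp (u s) 2 volume :=
    memLp_two_of_lintegral_lt_top hus.continuous ((hfe s hsI).trans_lt ENNReal.coe_lt_top)
  have hae : ∀ t ∈ Ioc 0 τ', (fun t => u (t + s)) t =ᵐ[volume] w t :=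
    serrin_weak_strong_uniqueness_holds hν hτ'pos hLHw hu₀ (q := ⊤) (r := ⊤) (by simp) (by simp)
      hS hLHu
  have heq : ∀ t ∈ Icc 0 τ', u (t + s) = w t := by
    intro t ht
    rcases eq_or_lt_of_le ht.1 with h0' | ht0
    · rw [← h0', zero_add, hw0]
    · have h := hae t ⟨ht0, ht.2⟩
      have htI : t + s ∈ Icc 0 T := ⟨by linarith, by linarith [ht.2]⟩
      exact (Continuous.ae_eq_iff_eq volume (hsol.contDiff_velocity htI).continuous
        (hwC t ht).continuous).1 h
  -- transfer of the derivative bounds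
  obtain ⟨C, hC⟩ := hDw n
  rw [hmin]
  refine ⟨C, fun t ht x => ?_⟩
  have hsm : ContDiffOn ℝ n (uncurry u) (Icc 0 T ×ˢ (univ : Set E3)) :=
    hsol.smooth_velocity.of_le (by exact_mod_cast le_top)
  have hsub : Icc s (s + τ') ×ˢ (univ : Set E3) ⊆ Icc 0 T ×ˢ univ :=
    prod_mono (Icc_subset_Icc hs0 hsτ'T) Subset.rfl
  have htx : ((t, x) : ℝ × E3) ∈ Icc s (s + τ') ×ˢ (univ : Set E3) := ⟨ht, mem_univ _⟩
  have hmem : ((t - s, x) : ℝ × E3) ∈ Icc 0 τ' ×ˢ (univ : Set E3) :=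
    ⟨⟨by linarith [ht.1], by linarith [ht.2]⟩, mem_univ _⟩
  have key1 : iteratedFDerivWithin ℝ n (uncurry u) (Icc 0 T ×ˢ univ) (t, x) =
      iteratedFDerivWithin ℝ n (uncurry u) (Icc s (s + τ') ×ˢ univ) (t, x) :=
    (iteratedFDerivWithin_subset hsub ((uniqueDiffOn_Icc (by linarith)).prod uniqueDiffOn_univ)
      ((uniqueDiffOn_Icc (by linarith)).prod uniqueDiffOn_univ) hsm htx).symm
  have hvadd : ((s, (0 : E3)) : ℝ × E3) +ᵥ (Icc 0 τ' ×ˢ (univ : Set E3)) =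
      Icc s (s + τ') ×ˢ univ := by
    ext ⟨r, y⟩
    rw [mem_vadd_set_iff_neg_vadd_mem, vadd_eq_add]
    simp only [Prod.neg_mk, neg_zero, Prod.mk_add_mk, zero_add, mem_prod, mem_Icc, mem_univ,
      and_true]
    constructor <;> rintro ⟨h1, h2⟩ <;> constructor <;> linarith
  have key2 : iteratedFDerivWithin ℝ n (uncurry u) (Icc s (s + τ') ×ˢ univ) (t, x) =
      iteratedFDerivWithin ℝ n (fun z : ℝ × E3 => uncurry u (z + (s, (0 : E3))))
        (Icc 0 τ' ×ˢ univ) (t - s, x) := by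
    rw [iteratedFDerivWithin_comp_add_right n ((s, (0 : E3)) : ℝ × E3) ((t - s, x)), hvadd]
    congr 1
    ext <;> simp
  have key3 : (fun z : ℝ × E3 => uncurry u (z + (s, (0 : E3)))) = uncurry fun r => u (r + s) := by
    funext ⟨r, y⟩
    simp
  have key4 : EqOn (uncurry fun r => u (r + s)) (uncurry w) (Icc 0 τ' ×ˢ (univ : Set E3)) := by
    rintro ⟨r, y⟩ hr
    simp only [uncurry_apply_pair, heq r hr.1]
  rw [key1, key2, key3, iteratedFDerivWithin_congr key4 hmem n]
  exact hC _ hmem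

end Summit.NavierStokesRegularity.NavierStokesRegularity.Theorems

end
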